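import Literature.AlgebraicGeometry.HodgeTheory.HomComplexShiftedHomUnit
import HarnessLib

/-!
# Derived duality for ONE-TERM vector-bundle complexes: `Hom_D(F₀^∨[0]-model, E₀^∨[0]-model⟦k⟧) ≃ Hom_D(E₀[0], F₀[0]⟦k⟧)`

Layer `Literature/AlgebraicGeometry/HodgeTheory`; a COROLLARY file of `HomComplexShiftedHomUnit.lean` (derived duality
`HomComplex.nonempty_shiftedHom_dualComplexUnit_equiv` for bounded complexes with finite locally free terms). The one-term case — `E• = E₀[0]`,
`F• = F₀[0]` for finite locally free `E₀`, `F₀`, window `[0, 0]` — stated with `(–)^∨ := 𝓗om•(–, 𝒪_X[0])` spelled through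
`HomologicalComplex.single … 0` exactly as in the bounced one-term proposal it re-files (same declaration name and statement; the proof is now the
specialisation of the general theorem instead of the tensor–Hom route):

* (private) `isFiniteLocallyFree_single₀_X'` — the terms of `E₀[0]` are finite locally free (`E₀` in degree `0`, zero elsewhere);
* **`nonempty_shiftedHom_dualComplexUnit_equiv_single E₀ F₀ hE₀ hF₀ k`**.

Everything is proved; 0 named facts. A bijection of Hom-sets only (no naturality, no linearity asserted). Library piece for ROAD K / (β3) of the
Hodge-programme crux 26512 (a research route conditional on HC_CM, not a corollary of anything here); nothing in this file speaks about that crux.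

## References

* R. Hartshorne, *Algebraic Geometry* (1977), III Prop. 6.7 (locally free duality `Ext^i(E ⊗ L^∨, F) ≅ Ext^i(E, L ⊗ F)`). [Hartshorne1977]
* The Stacks project, *Cohomology of Sheaves*, «Internal hom in the derived category», «Strictly perfect complexes» (Tags 08DH, 08C3). [StacksProject]
* C. A. Weibel, *An introduction to homological algebra* (1994), §10.4, 10.7. [Weibel1994]
-/

noncomputable section

open CategoryTheory CategoryTheory.Limits AlgebraicGeometry Opposite

universe w u

namespace Literature.AlgebraicGeometry.HodgeTheory

open Literature.AlgebraicGeometry.Modules Literature.AlgebraicGeometry.Motives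

variable (X : Scheme.{u}) [HasDerivedCategory.{w} X.Modules]

omit [HasDerivedCategory X.Modules] in
/-- The terms of `E₀[0]` are finite locally free for `E₀` finite locally free (`E₀` in degree `0`, `0` elsewhere).
[cite: Hartshorne1977, II §5 (locally free sheaves)] -/
private theorem isFiniteLocallyFree_single₀_X' (E₀ : X.Modules) (hE₀ : IsFiniteLocallyFree E₀) (p : ℤ) :
    IsFiniteLocallyFree ((HomComplex.single₀ X E₀).X p) := by
  by_cases hp : p = 0
  · subst hp
    exact isFiniteLocallyFree_of_iso (HomologicalComplex.singleObjXSelf (ComplexShape.up ℤ) 0 E₀).symm hE₀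
  · exact KTheory.KZero.isFiniteLocallyFree_of_isZero (HomologicalComplex.isZero_single_obj_X (ComplexShape.up ℤ) 0 E₀ p hp)

/-- **DERIVED DUALITY, ONE-TERM CASE**: for finite locally free `𝒪_X`-modules `E₀`, `F₀` and `k : ℤ`,
`Nonempty (Hom_D(Q 𝓗om•(F₀[0], 𝒪_X[0]), (Q 𝓗om•(E₀[0], 𝒪_X[0]))⟦k⟧) ≃ Hom_D(Q E₀[0], (Q F₀[0])⟦k⟧))` — the general derived duality
`HomComplex.nonempty_shiftedHom_dualComplexUnit_equiv` at the window `[0, 0]`. (On cohomology this is Hartshorne's `Ext^k(F₀^∨, E₀^∨) ≅ Ext^k(E₀, F₀)`.)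
[cite: Hartshorne1977, III Prop. 6.7] [cite: StacksProject, Cohomology of Sheaves, «Internal hom in the derived category» (Tag 08DH)] -/
theorem nonempty_shiftedHom_dualComplexUnit_equiv_single (E₀ F₀ : X.Modules) (hE₀ : IsFiniteLocallyFree E₀) (hF₀ : IsFiniteLocallyFree F₀)
    (k : ℤ) :
    Nonempty (ShiftedHom
        (DerivedCategory.Q.obj (homComplex X (HomComplex.single₀ X F₀) ((HomologicalComplex.single X.Modules (ComplexShape.up ℤ) 0).obj (unitModule X))))
        (DerivedCategory.Q.obj (homComplex X (HomComplex.single₀ X E₀) ((HomologicalComplex.single X.Modules (ComplexShape.up ℤ) 0).obj (unitModule X))))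
        k ≃
      ShiftedHom (DerivedCategory.Q.obj (HomComplex.single₀ X E₀)) (DerivedCategory.Q.obj (HomComplex.single₀ X F₀)) k) :=
  haveI : (HomComplex.single₀ X E₀).IsStrictlyGE 0 := inferInstanceAs (((CochainComplex.singleFunctor X.Modules 0).obj E₀).IsStrictlyGE 0)
  haveI : (HomComplex.single₀ X E₀).IsStrictlyLE 0 := inferInstanceAs (((CochainComplex.singleFunctor X.Modules 0).obj E₀).IsStrictlyLE 0)
  haveI : (HomComplex.single₀ X F₀).IsStrictlyGE 0 := inferInstanceAs (((CochainComplex.singleFunctor X.Modules 0).obj F₀).IsStrictlyGE 0)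
  haveI : (HomComplex.single₀ X F₀).IsStrictlyLE 0 := inferInstanceAs (((CochainComplex.singleFunctor X.Modules 0).obj F₀).IsStrictlyLE 0)
  HomComplex.nonempty_shiftedHom_dualComplexUnit_equiv X (HomComplex.single₀ X E₀) (HomComplex.single₀ X F₀) 0 0 0 0
    (isFiniteLocallyFree_single₀_X' X E₀ hE₀) (isFiniteLocallyFree_single₀_X' X F₀ hF₀) k

end Literature.AlgebraicGeometry.HodgeTheory

end
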